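import Literature.AlgebraicGeometry.Resolution.GeneralizedStabilityProofs
import Literature.AlgebraicGeometry.Resolution.GeneralizedStabilityTrdegOne
import HarnessLib

/-!
# Ramification and inertia along composite valuations; Kuhlmann 2010, Lemma 2.17

Topic: `Literature/AlgebraicGeometry/Resolution` (valued function fields). PROVED valuation
theory one layer below the generalized stability theorem of F.-V. Kuhlmann, *Elimination of
ramification I: The generalized stability theorem*, Trans. AMS 362 (2010) 5697–5727 =
arXiv:1003.5678 (the named fact `Kuhlmann2010Stability` of `ValuationDefect.lean` and its
decomposition `GeneralizedStability.lean` → `GeneralizedStabilityRational.lean` →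
`GeneralizedStabilityTrdegOne.lean`): the behaviour of the invariants `e`, `f` of
`ValuationDefect.lean` under COMPOSITION of valuations — for valuation rings `T ≤ W` of `L` and
`T̄ = T/𝔪_W ⊆ κ(W)` (`residueValuationSubring`, `CompositeValuations.lean`), over a subfield `K`
with `K ∩ W`, `K ∩ T` and `(K ∩ T)/𝔪_{K ∩ W} ⊆ κ(K ∩ W)` —

  `e(T/K) = e(W/K) · e(T̄/κ(K ∩ W))`,   `f(T/K) = f(T̄/κ(K ∩ W))`

(Bourbaki, *Alg. Comm.* VI §8 no. 3, proof of Thm. 1, formula (8): "`f(v̄ᵢ'/v̄) = f(vᵢ'/v)`,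
`e(w'/w) e(v̄ᵢ'/v̄) = e(vᵢ'/v)`"; Kuhlmann, proof of Lemma 2.17: "Using that
`e^w_i e_{ij} = ((wᵢ ∘ w̄ᵢⱼ)L : vK)`"), and with them **Lemma 2.17** of the source ("Let `(K, v)`
be a valued field with `v = w ∘ w̄`. If `(K, w)` and `(Kw, w̄)` are defectless fields, then so is
`(K, v)`"), the ingredient of the reduction of Thm. 1.1 to rank one (Lemma 5.4). The last section
records what the now PROVED fundamental inequality (`FundamentalInequality_holds`,
`GeneralizedStabilityProofs.lean`) makes unconditional: Cor. 2.16, and the reductions of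
`Kuhlmann2010Stability` to `Kuhlmann2010StabilityRational`, to
`Kuhlmann2010StabilityValueTranscendental`, and to the pair `Kuhlmann2010DefectlessDescent` +
`Kuhlmann2010StabilityAlgClosedValueTranscendental` (its current trust base).

## Content (everything PROVED)

* `comapAlgebra` (local instance `K ∩ W → W`, the local inclusion `comapSubringHom`; Mathlib then
  provides `Algebra (ResidueField (K ∩ W)) (ResidueField W)` = `residueFieldHom`,
  `algebraMap_residueField_eq`), `finrank_residueField` (`[κ(W) : κ(K ∩ W)] = f(W/K)`),
  `finiteDimensional_residueField`, `residueValuationSubring_comap` (`T̄` lies over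
  `(K ∩ T)/𝔪_{K ∩ W}`).
* `toResidueValuationSubring : T → T̄` (onto, local), `residueFieldEquivResidue : κ(T) ≃ κ(T̄)`,
  `inertiaDegree_residueValuationSubring` — **`f(T/K) = f(T̄/κ(K ∩ W))`**.
* `unitsSup K S = K^× S^× ⊆ L^×`, `ramificationIndex_eq_index` (`e(S/K) = [L^× : K^× S^×]`),
  `unitGroupToResidueFieldUnits_mem_iff`, `comap_unitsSup_residue` (under Mathlib's reduction
  `W^× → κ(W)^×`, `κ(K ∩ W)^× T̄^×` pulls back to `W^× ∩ K^× T^×`),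
  `ramificationIndex_eq_mul_residue` — **`e(T/K) = e(W/K) · e(T̄/κ(K ∩ W))`**.
* `eq_of_residueValuationSubring_eq`, `residueValuationSubring_residueOverringLift`,
  `eq_of_le_of_le_of_comap_eq` — `T ↦ T̄` is injective with inverse the pull-back, and a
  valuation ring of `L` has at most one coarsening over a given valuation ring of `K`
  (`L/K` finite).
* `IsDefectlessField.of_le_of_residue` — **Kuhlmann 2010, Lemma 2.17**, along the printed proof.
* `IsDefectlessField.finiteDimensional` (Cor. 2.16 unconditionally),
  `Kuhlmann2010Stability.of_rational`, `Kuhlmann2010Stability.of_stabilityValueTranscendental`,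
  `Kuhlmann2010Stability.of_defectlessDescent_of_algClosed`.

## Sources

* F.-V. Kuhlmann, Trans. AMS 362 (2010) = arXiv:1003.5678: §1 (1) (p. 3); §2.3, Cor. 2.16 and
  Lemma 2.17 with its proof (p. 7); §5, Lemmas 5.1, 5.2, 5.4 (pp. 18–19).
* N. Bourbaki, *Algèbre commutative*, Ch. VI §8 no. 3, Thm. 1, proof, formula (8).

## Rendering notes

* As in `ValuationDefect.lean`: an extension of valued fields is `[Algebra K L]` with a valuation
  ring `W` of `L`, the valuation ring of `K` being `W.comap (algebraMap K L)` ("`K ∩ W`").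
  `v = w ∘ w̄` on `K` is `O ≤ O₁` (`v ↔ O`, `w ↔ O₁`) with `w̄ ↔ residueValuationSubring O O₁`.
* `e(T/K) = [ |L^×|_T : |K^×| ]` is computed in `L^×` as the index of `K^× T^×`
  (`ramificationIndex_eq_index`), which makes the product formula a statement about subgroups
  of `L^×` and `W^× ⊆ L^×` (`ValuationSubring.unitGroup`).
-/

noncomputable section

open IsLocalRing

namespace Literature.AlgebraicGeometry.Resolution

universe u

/-! ### Composite valuations: `e` and `f` along `T ≤ W` -/

section Composite

variable (K : Type u) {L : Type u} [Field K] [Field L] [Algebra K L]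

/-- `K ∩ L° → L°` as an algebra (the local inclusion `comapSubringHom`), so that Mathlib's
`Algebra (ResidueField (K ∩ L°)) (ResidueField L°)` — the embedding `K̃ → L̃` — is available.
[folklore] -/
@[reducible]
def comapAlgebra (W : ValuationSubring L) : Algebra (W.comap (algebraMap K L)) W :=
  (comapSubringHom K W).toAlgebra

attribute [local instance] comapAlgebra

/-- `K ∩ L° → L°` is local. [folklore] -/
theorem isLocalHom_algebraMap_comap (W : ValuationSubring L) :
    IsLocalHom (algebraMap (W.comap (algebraMap K L)) W) :=
  isLocalHom_comapSubringHom K W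

attribute [local instance] isLocalHom_algebraMap_comap

/-- The residue field embedding `κ(K ∩ L°) → κ(L°)` given by the algebra structure is
`residueFieldHom`. [folklore] -/
theorem algebraMap_residueField_eq (W : ValuationSubring L) :
    algebraMap (ResidueField (W.comap (algebraMap K L))) (ResidueField W) = residueFieldHom K W := by
  refine RingHom.ext fun x => ?_
  obtain ⟨x, rfl⟩ := residue_surjective x
  rw [IsLocalRing.ResidueField.algebraMap_residue, residueFieldHom_residue]
  rfl

/-- `[κ(L°) : κ(K ∩ L°)] = f(L°/K)`. [folklore] -/
theorem finrank_residueField (W : ValuationSubring L) :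
    Module.finrank (ResidueField (W.comap (algebraMap K L))) (ResidueField W) = inertiaDegree K W := by
  have h := finrank_fieldRange_eq (ResidueField (W.comap (algebraMap K L))) (L := ResidueField W)
  rw [algebraMap_residueField_eq, fieldRange_residueFieldHom] at h
  exact h.symm

/-- For `L/K` finite, `κ(L°)` is finite over `κ(K ∩ L°)`. [folklore] -/
theorem finiteDimensional_residueField [FiniteDimensional K L] (W : ValuationSubring L) :
    FiniteDimensional (ResidueField (W.comap (algebraMap K L))) (ResidueField W) :=
  Module.finite_of_finrank_pos (by
    rw [finrank_residueField]
    exact (one_le_ramificationIndex_and_inertiaDegree K W).2)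

/-- **Residue valuation rings restrict correctly**: for `T ≤ W` valuation rings of `L`, the
valuation ring `T̄ = T/𝔪_W` of `κ(W)` lies over the valuation ring `(K ∩ T)/𝔪_{K ∩ W}` of
`κ(K ∩ W)`. [folklore] -/
theorem residueValuationSubring_comap (T W : ValuationSubring L) (h : T ≤ W) :
    (residueValuationSubring T W h).comap
        (algebraMap (ResidueField (W.comap (algebraMap K L))) (ResidueField W)) =
      residueValuationSubring (T.comap (algebraMap K L)) (W.comap (algebraMap K L))
        (comap_algebraMap_mono K h) := by
  ext r
  obtain ⟨c, rfl⟩ := residue_surjective r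
  rw [ValuationSubring.mem_comap, IsLocalRing.ResidueField.algebraMap_residue,
    residue_mem_residueValuationSubring_iff, residue_mem_residueValuationSubring_iff]
  rfl

/-! #### `f(T/K) = f(T̄/κ(K ∩ W))` -/

variable {K}

/-- The reduction map `T → T̄ = T/𝔪_W ⊆ κ(W)` for `T ≤ W`. [folklore] -/
def toResidueValuationSubring (T W : ValuationSubring L) (h : T ≤ W) :
    T →+* residueValuationSubring T W h :=
  ((residue W).comp (T.inclusion W h)).codRestrict (residueValuationSubring T W h) fun t => ⟨t, rfl⟩

/-- `T → T̄` on elements. [folklore] -/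
@[simp]
theorem coe_toResidueValuationSubring (T W : ValuationSubring L) (h : T ≤ W) (t : T) :
    (toResidueValuationSubring T W h t : ResidueField W) = residue W (T.inclusion W h t) := rfl

/-- `T → T̄` is onto. [folklore] -/
theorem toResidueValuationSubring_surjective (T W : ValuationSubring L) (h : T ≤ W) :
    Function.Surjective (toResidueValuationSubring T W h) := by
  rintro ⟨_, t, rfl⟩
  exact ⟨t, rfl⟩

/-- `T → T̄` is a local homomorphism (`𝔪_W ⊆ 𝔪_T`). [folklore] -/
theorem isLocalHom_toResidueValuationSubring (T W : ValuationSubring L) (h : T ≤ W) :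
    IsLocalHom (toResidueValuationSubring T W h) := by
  refine ⟨fun t ht => ?_⟩
  obtain ⟨y, hy⟩ := ht.exists_right_inv
  obtain ⟨s, rfl⟩ := toResidueValuationSubring_surjective T W h y
  rw [← map_mul, ← map_one (toResidueValuationSubring T W h), ← sub_eq_zero, ← map_sub] at hy
  have hval : residue W (T.inclusion W h (t * s - 1)) = 0 := by
    have := congrArg (fun z : residueValuationSubring T W h => (z : ResidueField W)) hy
    simpa using this
  rw [residue_eq_zero_iff] at hval
  -- `z = ts - 1` is a non-unit of `T`, so `ts ∉ 𝔪_T`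
  have hz : ¬IsUnit (t * s - 1) := fun hu =>
    (IsLocalRing.mem_maximalIdeal _).mp hval (hu.map (T.inclusion W h))
  have hts : IsUnit (t * s) := by
    by_contra hnu
    have h1 : t * s ∈ IsLocalRing.maximalIdeal T := (IsLocalRing.mem_maximalIdeal _).mpr hnu
    have h2 : t * s - 1 ∈ IsLocalRing.maximalIdeal T := (IsLocalRing.mem_maximalIdeal _).mpr hz
    have h3 : (1 : T) ∈ IsLocalRing.maximalIdeal T := by
      have := Ideal.sub_mem _ h1 h2
      rwa [sub_sub_cancel] at this
    exact (IsLocalRing.maximalIdeal.isMaximal T).ne_top ((Ideal.eq_top_iff_one _).mpr h3)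
  exact isUnit_of_mul_isUnit_left hts

/-- **`κ(T) ≅ κ(T̄)`**: a valuation ring `T ≤ W` and its image `T̄ = T/𝔪_W` in `κ(W)` have the
same residue field. [folklore] -/
def residueFieldEquivResidue (T W : ValuationSubring L) (h : T ≤ W) :
    ResidueField T ≃+* ResidueField (residueValuationSubring T W h) :=
  haveI := isLocalHom_toResidueValuationSubring T W h
  RingEquiv.ofBijective (IsLocalRing.ResidueField.map (toResidueValuationSubring T W h))
    ⟨RingHom.injective _, fun x => by
      obtain ⟨y, rfl⟩ := residue_surjective x
      obtain ⟨t, rfl⟩ := toResidueValuationSubring_surjective T W h y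
      exact ⟨residue T t, IsLocalRing.ResidueField.map_residue _ _⟩⟩

/-- `κ(T) ≅ κ(T̄)` on residues. [folklore] -/
theorem residueFieldEquivResidue_residue (T W : ValuationSubring L) (h : T ≤ W) (t : T) :
    residueFieldEquivResidue T W h (residue T t) =
      residue (residueValuationSubring T W h) (toResidueValuationSubring T W h t) :=
  haveI := isLocalHom_toResidueValuationSubring T W h
  IsLocalRing.ResidueField.map_residue _ _

variable (K)

/-- **`f` along a composite valuation**: `f(T/K) = f(T̄/κ(K ∩ W))` for `T ≤ W` — the residue
fields of `T` and `T̄` agree, compatibly with the subfields of residues of `K`.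
[cite: BourbakiAC5to7, Ch. VI §8 no. 3, proof of Th. 1, (8)] -/
theorem inertiaDegree_residueValuationSubring (T W : ValuationSubring L) (h : T ≤ W) :
    inertiaDegree (ResidueField (W.comap (algebraMap K L))) (residueValuationSubring T W h) =
      inertiaDegree K T := by
  set Kr := ResidueField (W.comap (algebraMap K L))
  set T' := residueValuationSubring T W h
  let φ := toResidueValuationSubring T W h
  let j : ResidueField T ≃+* ResidueField T' := residueFieldEquivResidue T W h
  have hj : ∀ t : T, j (residue T t) = residue T' (φ t) := residueFieldEquivResidue_residue T W h
  -- the subfields of residues of `K` correspond under `j`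
  have hmem : ∀ y, y ∈ residueSubfield K T ↔ j y ∈ residueSubfield Kr T' := by
    intro y
    constructor
    · intro hy
      obtain ⟨c, hc, rfl⟩ := (mem_residueSubfield_iff K T y).mp hy
      rw [hj, mem_residueSubfield_iff]
      have hcW : c ∈ W.comap (algebraMap K L) := h hc
      have hmemT' : algebraMap Kr (ResidueField W) (residue _ ⟨c, hcW⟩) ∈ T' :=
        (residue_mem_residueValuationSubring_iff T W h _).mpr hc
      refine ⟨residue _ ⟨c, hcW⟩, hmemT', ?_⟩
      congr 1
    · intro hy
      obtain ⟨r, hr, hry⟩ := (mem_residueSubfield_iff Kr T' _).mp hy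
      obtain ⟨c, rfl⟩ := residue_surjective r
      have hcT : algebraMap K L (c : K) ∈ T :=
        (residue_mem_residueValuationSubring_iff T W h (algebraMap _ W c)).mp hr
      have hyc : y = residue T ⟨algebraMap K L c, hcT⟩ := by
        apply j.injective
        rw [← hry, hj]
        congr 1
      rw [hyc]
      exact residue_mem_residueSubfield K T c hcT
  -- the induced isomorphism of subfields
  let i : residueSubfield K T ≃+* residueSubfield Kr T' :=
    RingEquiv.ofBijective
      (j.toRingHom.restrict (residueSubfield K T) (residueSubfield Kr T') fun y hy => (hmem y).mp hy)
      ⟨fun a b hab => Subtype.ext (j.injective (congrArg Subtype.val hab)), fun z =>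
        ⟨⟨j.symm z, (hmem _).mpr (by rw [RingEquiv.apply_symm_apply]; exact z.2)⟩,
          Subtype.ext (j.apply_symm_apply z)⟩⟩
  unfold inertiaDegree
  exact (Algebra.finrank_eq_of_equiv_equiv i j (RingHom.ext fun y => rfl)).symm

/-! #### `e(T/K) = e(W/K) · e(T̄/κ(K ∩ W))` -/

/-- `|·| : L^× → |L^×|` is onto. [folklore] -/
theorem unitsMap_valuation_surjective (S : ValuationSubring L) :
    Function.Surjective (Units.map S.valuation.toMonoidHom) := by
  intro γ
  obtain ⟨x, hx⟩ := S.valuation_surjective (γ : S.ValueGroup)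
  have hx0 : x ≠ 0 := fun h => by
    rw [h, map_zero] at hx
    exact γ.ne_zero hx.symm
  exact ⟨Units.mk0 x hx0, Units.ext hx⟩

/-- The kernel of `|·| : L^× → |L^×|` is the unit group of the valuation ring. [folklore] -/
theorem ker_unitsMap_valuation (S : ValuationSubring L) :
    (Units.map S.valuation.toMonoidHom).ker = S.unitGroup := by
  ext x
  rw [MonoidHom.mem_ker, Units.ext_iff, ValuationSubring.mem_unitGroup_iff]
  rfl

/-- `|K^×| ⊆ |L^×|` is the image of `K^× ⊆ L^×`. [folklore] -/
theorem valueSubgroup_eq_map (S : ValuationSubring L) :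
    valueSubgroup K S =
      ((Units.map (algebraMap K L : K →* L)).range).map (Units.map S.valuation.toMonoidHom) := by
  rw [MonoidHom.map_range]
  rfl

/-- `K^× · S^× ⊆ L^×` for a valuation ring `S` of `L`. [folklore] -/
def unitsSup (S : ValuationSubring L) : Subgroup Lˣ :=
  (Units.map (algebraMap K L : K →* L)).range ⊔ S.unitGroup

/-- **`e(S/K) = [L^× : K^× S^×]`**. [folklore] -/
theorem ramificationIndex_eq_index (S : ValuationSubring L) :
    ramificationIndex K S = (unitsSup K S).index := by
  unfold ramificationIndex unitsSup
  rw [valueSubgroup_eq_map, Subgroup.index_map, ker_unitsMap_valuation,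
    MonoidHom.range_eq_top.mpr (unitsMap_valuation_surjective S), Subgroup.index_top, mul_one]

variable {K}

/-- Membership in the unit group of a valuation ring: `x` and `x⁻¹` lie in it. [folklore] -/
theorem mem_unitGroup_iff_mem (A : ValuationSubring L) (x : Lˣ) :
    x ∈ A.unitGroup ↔ (x : L) ∈ A ∧ ((x⁻¹ : Lˣ) : L) ∈ A := by
  rw [ValuationSubring.mem_unitGroup_iff, ← A.valuation_le_one_iff, ← A.valuation_le_one_iff,
    Units.val_inv_eq_inv_val, map_inv₀]
  have h0 : A.valuation (x : L) ≠ 0 := (Valuation.ne_zero_iff _).mpr x.ne_zero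
  constructor
  · intro h
    rw [h, inv_one]
    exact ⟨le_rfl, le_rfl⟩
  · rintro ⟨h1, h2⟩
    rw [inv_le_one₀ (zero_lt_iff.mpr h0)] at h2
    exact le_antisymm h1 h2

/-- Under the reduction `W^× → κ(W)^×` (Mathlib's `ValuationSubring.unitGroupToResidueFieldUnits`
on the unit group `W^× ⊆ L^×`), the units of `T̄ = T/𝔪_W` pull back to `T^×` (`T ≤ W`).
[folklore] -/
theorem unitGroupToResidueFieldUnits_mem_iff (T W : ValuationSubring L) (h : T ≤ W)
    (y : W.unitGroup) :
    W.unitGroupToResidueFieldUnits y ∈ (residueValuationSubring T W h).unitGroup ↔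
      (y : Lˣ) ∈ T.unitGroup := by
  rw [mem_unitGroup_iff_mem, mem_unitGroup_iff_mem]
  have h1 : (W.unitGroupToResidueFieldUnits y : ResidueField W) ∈ residueValuationSubring T W h ↔
      ((y : Lˣ) : L) ∈ T :=
    residue_mem_residueValuationSubring_iff T W h (W.unitGroupMulEquiv y : W)
  have h2 : (((W.unitGroupToResidueFieldUnits y)⁻¹ : (ResidueField W)ˣ) : ResidueField W) ∈
      residueValuationSubring T W h ↔ (((y : Lˣ)⁻¹ : Lˣ) : L) ∈ T := by
    rw [← map_inv]
    exact residue_mem_residueValuationSubring_iff T W h (W.unitGroupMulEquiv y⁻¹ : W)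
  rw [h1, h2]

variable (K)

/-- **The heart of `e(T/K) = e(W/K) e(T̄/κ(K ∩ W))`**: under `W^× → κ(W)^×`, the subgroup
`κ(K ∩ W)^× · T̄^×` pulls back to `W^× ∩ K^× T^×`. [folklore] -/
theorem comap_unitsSup_residue (T W : ValuationSubring L) (h : T ≤ W) :
    (unitsSup (ResidueField (W.comap (algebraMap K L))) (residueValuationSubring T W h)).comap
        W.unitGroupToResidueFieldUnits =
      (unitsSup K T).subgroupOf W.unitGroup := by
  set Kr := ResidueField (W.comap (algebraMap K L))
  set T' := residueValuationSubring T W h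
  ext y
  rw [Subgroup.mem_comap, Subgroup.mem_subgroupOf, unitsSup, unitsSup, Subgroup.mem_sup,
    Subgroup.mem_sup]
  constructor
  · rintro ⟨a', ⟨r, rfl⟩, b', hb', hab⟩
    -- lift `r ∈ κ(K ∩ W)^×` to a unit `c` of `K ∩ W`
    obtain ⟨c, hc⟩ := residue_surjective (r : Kr)
    have hcu : IsUnit c := by
      by_contra hn
      have h0 : residue _ c = 0 :=
        (residue_eq_zero_iff _).mpr ((IsLocalRing.mem_maximalIdeal _).mpr hn)
      rw [hc] at h0
      exact r.ne_zero h0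
    have hc0 : (c : K) ≠ 0 := fun h0 => by
      apply hcu.ne_zero
      exact Subtype.ext h0
    have hcW : IsUnit (algebraMap _ W c) := hcu.map _
    let a₁ : W.unitGroup := W.unitGroupMulEquiv.symm hcW.unit
    have ha₁ : W.unitGroupToResidueFieldUnits a₁ =
        Units.map (algebraMap Kr (ResidueField W) : Kr →* _) r :=
      Units.ext (by
        rw [ValuationSubring.coe_unitGroupToResidueFieldUnits_apply, MulEquiv.apply_symm_apply,
          IsUnit.unit_spec, Units.coe_map, MonoidHom.coe_coe, ← hc]
        rfl)
    have hb'eq : b' = W.unitGroupToResidueFieldUnits (a₁⁻¹ * y) := by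
      rw [map_mul, map_inv, ha₁, eq_inv_mul_iff_mul_eq]
      exact hab
    have hmem : ((a₁⁻¹ * y : W.unitGroup) : Lˣ) ∈ T.unitGroup :=
      (unitGroupToResidueFieldUnits_mem_iff T W h _).mp (hb'eq ▸ hb')
    refine ⟨(a₁ : Lˣ), ⟨Units.mk0 (c : K) hc0, Units.ext ?_⟩, _, hmem, ?_⟩
    · rw [Units.coe_map, MonoidHom.coe_coe, Units.val_mk0]
      rfl
    · rw [Subgroup.coe_mul, Subgroup.coe_inv, mul_inv_cancel_left]
  · rintro ⟨a, ⟨c, rfl⟩, b, hb, hab⟩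
    have hbW : b ∈ W.unitGroup := ValuationSubring.unitGroup_le_unitGroup.mpr h hb
    have haW : Units.map (algebraMap K L : K →* L) c ∈ W.unitGroup := by
      have : Units.map (algebraMap K L : K →* L) c = (y : Lˣ) * b⁻¹ := by
        rw [← hab, mul_inv_cancel_right]
      rw [this]
      exact W.unitGroup.mul_mem y.2 (W.unitGroup.inv_mem hbW)
    let a₁ : W.unitGroup := ⟨_, haW⟩
    let b₁ : W.unitGroup := ⟨b, hbW⟩
    have hy : y = a₁ * b₁ := Subtype.ext hab.symm
    -- `c` lies in `K ∩ W` and is a unit there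
    have hcO : (c : K) ∈ W.comap (algebraMap K L) := by
      change algebraMap K L c ∈ W
      have h1 : W.valuation (Units.map (algebraMap K L : K →* L) c : L) = 1 := haW
      exact (W.valuation_le_one_iff _).mp h1.le
    have hcu : IsUnit (⟨c, hcO⟩ : W.comap (algebraMap K L)) := by
      apply isUnit_of_map_unit (algebraMap _ W)
      rw [ValuationSubring.valuation_eq_one_iff]
      exact haW
    refine ⟨W.unitGroupToResidueFieldUnits a₁, ⟨Units.map (residue _).toMonoidHom hcu.unit,
      Units.ext ?_⟩, W.unitGroupToResidueFieldUnits b₁,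
      (unitGroupToResidueFieldUnits_mem_iff T W h b₁).mpr hb, by rw [hy, map_mul]⟩
    rw [Units.coe_map, MonoidHom.coe_coe, Units.coe_map, RingHom.toMonoidHom_eq_coe,
      MonoidHom.coe_coe, IsUnit.unit_spec, IsLocalRing.ResidueField.algebraMap_residue,
      ValuationSubring.coe_unitGroupToResidueFieldUnits_apply]
    rfl

/-- **`e` along a composite valuation**: `e(T/K) = e(W/K) · e(T̄/κ(K ∩ W))` for `T ≤ W`
(the exact sequences `0 → Γ_{T̄} → Γ_T → Γ_W → 0` over `L` and over `K`).
[cite: BourbakiAC5to7, Ch. VI §8 no. 3, proof of Th. 1, (8)] -/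
theorem ramificationIndex_eq_mul_residue (T W : ValuationSubring L) (h : T ≤ W) :
    ramificationIndex K T = ramificationIndex K W *
      ramificationIndex (ResidueField (W.comap (algebraMap K L))) (residueValuationSubring T W h) := by
  have hidx := Subgroup.index_comap_of_surjective
    (unitsSup (ResidueField (W.comap (algebraMap K L))) (residueValuationSubring T W h))
    W.surjective_unitGroupToResidueFieldUnits
  rw [comap_unitsSup_residue K T W h] at hidx
  rw [ramificationIndex_eq_index, ramificationIndex_eq_index, ramificationIndex_eq_index, ← hidx]
  have hle : unitsSup K T ≤ unitsSup K W :=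
    sup_le_sup_left (ValuationSubring.unitGroup_le_unitGroup.mpr h) _
  rw [← Subgroup.relIndex_mul_index hle, mul_comm]
  congr 1
  have hW : unitsSup K W = unitsSup K T ⊔ W.unitGroup := by
    unfold unitsSup
    rw [sup_assoc, sup_eq_right.mpr (ValuationSubring.unitGroup_le_unitGroup.mpr h)]
  rw [hW, Subgroup.relIndex_sup_left]
  rfl

/-! #### The lattice of valuation rings of `κ(W)` -/

variable {K}

/-- `T ↦ T̄ = T/𝔪_W` is injective on valuation rings `T ≤ W`. [folklore] -/
theorem eq_of_residueValuationSubring_eq {T₁ T₂ W : ValuationSubring L} (h₁ : T₁ ≤ W) (h₂ : T₂ ≤ W)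
    (h : residueValuationSubring T₁ W h₁ = residueValuationSubring T₂ W h₂) : T₁ = T₂ := by
  ext x
  by_cases hx : x ∈ W
  · have h' := residue_mem_residueValuationSubring_iff T₁ W h₁ ⟨x, hx⟩
    rw [h, residue_mem_residueValuationSubring_iff] at h'
    exact h'.symm
  · exact ⟨fun h' => absurd (h₁ h') hx, fun h' => absurd (h₂ h') hx⟩

end Composite

/-! ### Defectless fields and composite valuations (Kuhlmann 2010, Lemma 2.17) -/

section CompositeDefectless

attribute [local instance] comapAlgebra isLocalHom_algebraMap_comap

variable {L : Type u} [Field L]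

/-- `T̄ ↦ {x ∈ W | x̄ ∈ T̄}` followed by reduction is the identity on valuation rings of `κ(W)`.
[folklore] -/
theorem residueValuationSubring_residueOverringLift (W : ValuationSubring L)
    (S' : ValuationSubring (ResidueField W)) :
    residueValuationSubring (residueOverringLift W S') W (residueOverringLift_le W S') = S' := by
  ext r
  obtain ⟨y, rfl⟩ := residue_surjective r
  rw [residue_mem_residueValuationSubring_iff, mem_residueOverringLift_iff]
  exact ⟨fun ⟨_, h⟩ => h, fun h => ⟨y.2, h⟩⟩

/-- Two coarsenings of one valuation ring of `L` inducing the same valuation ring of `K` coincide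
(`L/K` finite). [folklore] -/
theorem eq_of_le_of_le_of_comap_eq (K : Type u) [Field K] [Algebra K L] [FiniteDimensional K L]
    {T W W' : ValuationSubring L} (hW : T ≤ W) (hW' : T ≤ W')
    (h : W.comap (algebraMap K L) = W'.comap (algebraMap K L)) : W = W' := by
  rcases le_total (⟨W, hW⟩ : {S // T ≤ S}) ⟨W', hW'⟩ with hle | hle
  · exact eq_of_le_of_comap_eq K W W' hle h
  · exact (eq_of_le_of_comap_eq K W' W hle h.symm).symm

/-- **Kuhlmann 2010, Lemma 2.17** ("Let `(K, v)` be a valued field with `v = w ∘ w̄`. If `(K, w)`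
and `(Kw, w̄)` are defectless fields, then so is `(K, v)`"). Rendering: `v ↔ O ≤ O₁ ↔ w`
valuation rings of `K`, `w̄ ↔ O/𝔪_{O₁} ⊆ κ(O₁)` (`residueValuationSubring`). PROVED along the
printed proof: for `L/K` finite, the extensions `Wᵢ` of `O₁` to `L` satisfy
`∑ e(Wᵢ) f(Wᵢ) = [L : K]`; for each `i` the extensions `T̄ᵢⱼ` of `O/𝔪_{O₁}` to `κ(Wᵢ)`
(finite over `κ(O₁)`, of degree `f(Wᵢ)`) satisfy `∑ⱼ e(T̄ᵢⱼ) f(T̄ᵢⱼ) = f(Wᵢ)`; their pull-backs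
`Tᵢⱼ ⊆ Wᵢ` are pairwise distinct extensions of `O` to `L` with `e(Tᵢⱼ) = e(Wᵢ) e(T̄ᵢⱼ)`,
`f(Tᵢⱼ) = f(T̄ᵢⱼ)`, so `∑ᵢⱼ e(Tᵢⱼ) f(Tᵢⱼ) = [L : K]`, and by the fundamental inequality they
are all the extensions of `O`, with equality. [cite: Kuhlmann2010, Lemma 2.17] -/
theorem IsDefectlessField.of_le_of_residue {K : Type u} [Field K] (O O₁ : ValuationSubring K)
    (h : O ≤ O₁) (h₁ : IsDefectlessField K O₁)
    (h₂ : IsDefectlessField (ResidueField O₁) (residueValuationSubring O O₁ h)) :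
    IsDefectlessField K O := by
  intro L _ _ hfin
  classical
  haveI := hfin
  -- all extensions of `O` (fundamental inequality)
  obtain ⟨s, hs, hle⟩ := FundamentalInequality_holds K L hfin O
  refine ⟨s, hs, le_antisymm hle ?_⟩
  -- the extensions `W` of `O₁`
  obtain ⟨s₁, hs₁, hsum₁⟩ := h₁ L hfin
  -- for each of them, the lifted extensions of `O/𝔪_{O₁}` through `κ(W)`
  have hW : ∀ W ∈ s₁, ∃ t : Finset (ValuationSubring L), t ⊆ s ∧ (∀ T ∈ t, T ≤ W) ∧
      ∑ T ∈ t, ramificationIndex K T * inertiaDegree K T =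
        ramificationIndex K W * inertiaDegree K W := by
    intro W hW₁
    have hWc : W.comap (algebraMap K L) = O₁ := (hs₁ W).mp hW₁
    subst hWc
    haveI := finiteDimensional_residueField K W
    obtain ⟨s₂, hs₂, hsum₂⟩ := h₂ (ResidueField W) inferInstance
    refine ⟨s₂.image (residueOverringLift W), fun T hT => ?_, fun T hT => ?_, ?_⟩
    · -- a lift is an extension of `O`
      obtain ⟨S', hS', rfl⟩ := Finset.mem_image.mp hT
      rw [hs]
      have hc := residueValuationSubring_comap K (residueOverringLift W S') W
        (residueOverringLift_le W S')
      rw [residueValuationSubring_residueOverringLift, (hs₂ S').mp hS'] at hc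
      exact eq_of_residueValuationSubring_eq _ _ hc.symm
    · obtain ⟨S', -, rfl⟩ := Finset.mem_image.mp hT
      exact residueOverringLift_le W S'
    · rw [Finset.sum_image fun S' _ S'' _ hS => by
        rw [← residueValuationSubring_residueOverringLift W S',
          ← residueValuationSubring_residueOverringLift W S'']
        simp only [hS]]
      rw [← finrank_residueField K W, ← hsum₂, Finset.mul_sum]
      refine Finset.sum_congr rfl fun S' _ => ?_
      rw [ramificationIndex_eq_mul_residue K (residueOverringLift W S') W (residueOverringLift_le W S'),
        ← inertiaDegree_residueValuationSubring K (residueOverringLift W S') W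
          (residueOverringLift_le W S'),
        residueValuationSubring_residueOverringLift]
      ring
  choose! t ht_sub ht_le ht_sum using hW
  -- the lifted families for distinct `W` are disjoint
  have hdisj : (↑s₁ : Set (ValuationSubring L)).PairwiseDisjoint t := by
    intro W hW W' hW' hne
    refine Finset.disjoint_left.mpr fun T hT hT' => hne ?_
    exact eq_of_le_of_le_of_comap_eq K (ht_le W hW T hT) (ht_le W' hW' T hT')
      (((hs₁ W).mp hW).trans ((hs₁ W').mp hW').symm)
  calc Module.finrank K L = ∑ W ∈ s₁, ramificationIndex K W * inertiaDegree K W := hsum₁.symm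
    _ = ∑ W ∈ s₁, ∑ T ∈ t W, ramificationIndex K T * inertiaDegree K T :=
        Finset.sum_congr rfl fun W hW => (ht_sum W hW).symm
    _ = ∑ T ∈ s₁.biUnion t, ramificationIndex K T * inertiaDegree K T :=
        (Finset.sum_biUnion hdisj).symm
    _ ≤ ∑ T ∈ s, ramificationIndex K T * inertiaDegree K T :=
        Finset.sum_le_sum_of_subset (Finset.biUnion_subset.mpr fun W hW => ht_sub W hW)

end CompositeDefectless


/-! ### Consequences of the fundamental inequality for the generalized stability theorem -/

/-- **Kuhlmann 2010, Cor. 2.16, unconditionally**: a finite extension `(L, L°)` of a defectless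
valued field `(K, L° ∩ K)` is a defectless valued field. PROVED
(`IsDefectlessField.of_finiteDimensional` of `GeneralizedStability.lean` and
`FundamentalInequality_holds` of `GeneralizedStabilityProofs.lean`).
[cite: Kuhlmann2010, Cor. 2.16] -/
theorem IsDefectlessField.finiteDimensional {K L : Type u} [Field K] [Field L] [Algebra K L]
    [FiniteDimensional K L] (O' : ValuationSubring L)
    (h : IsDefectlessField K (O'.comap (algebraMap K L))) : IsDefectlessField L O' :=
  IsDefectlessField.of_finiteDimensional FundamentalInequality_holds O' h

/-- **The generalized stability theorem over a trivially valued ground field, from its rational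
case alone**: with the fundamental inequality proved (`GeneralizedStabilityProofs.lean`), the
named fact `Kuhlmann2010Stability`
(`ValuationDefect.lean`; Kuhlmann 2010, Thm. 1.1 for `k` trivially valued) follows from
`Kuhlmann2010StabilityRational` (Thm. 1.1 for `k(x, y)` with a standard valuation transcendence
basis) by `Kuhlmann2010Stability.of_parts` (Cor. 2.6 and Cor. 2.16 of the source).
[cite: Kuhlmann2010, Thm. 1.1] -/
theorem Kuhlmann2010Stability.of_rational (hR : Kuhlmann2010StabilityRational.{u}) :
    Kuhlmann2010Stability.{u} :=
  Kuhlmann2010Stability.of_parts FundamentalInequality_holds hR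

/-- **The generalized stability theorem over a trivially valued ground field, from Thm. 1.1 in
transcendence degree one with a value-transcendental generator alone**: the trust base of the
named fact `Kuhlmann2010Stability` is now exactly `{Kuhlmann2010StabilityValueTranscendental}`
(`GeneralizedStabilityRational.lean`: Lemma 5.1 of the source for the rational case), the
fundamental inequality being proved. [cite: Kuhlmann2010, Thm. 1.1, Section 5, Lemma 5.1] -/
theorem Kuhlmann2010Stability.of_stabilityValueTranscendental
    (hVT : Kuhlmann2010StabilityValueTranscendental.{u}) : Kuhlmann2010Stability.{u} :=
  Kuhlmann2010Stability.of_valueTranscendental FundamentalInequality_holds hVT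

/-- **The generalized stability theorem over a trivially valued ground field from Cor. 2.25 and
(R2)** (the current frontier of the decomposition, `GeneralizedStabilityTrdegOne.lean`,
Lemma 5.2 of the source): `Kuhlmann2010Stability` follows from the named facts
`Kuhlmann2010DefectlessDescent` (Cor. 2.25) and
`Kuhlmann2010StabilityAlgClosedValueTranscendental` ((R2) for `K̃(t)`) alone.
[cite: Kuhlmann2010, Thm. 1.1, Section 5, Lemmas 5.1–5.2] -/
theorem Kuhlmann2010Stability.of_defectlessDescent_of_algClosed
    (hD : Kuhlmann2010DefectlessDescent.{u})
    (hAC : Kuhlmann2010StabilityAlgClosedValueTranscendental.{u}) : Kuhlmann2010Stability.{u} :=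
  Kuhlmann2010Stability.of_descent_of_algClosed FundamentalInequality_holds hD hAC

end Literature.AlgebraicGeometry.Resolution
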